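import Summits.QuantumFields.YangMills.Theorems.AlphaInputsT3ACCumulantLeavesOfLoc59Rows
import HarnessLib

/-!
# `AlphaInputsT3ACCumulantLeavesAtLetter` — THE (R1)+(R2′) JOINT DOOR EDITIONS AT THE PRINTED-ROW CUMULANT LETTER: «(D→) and (D←) of the (R2′) re-cut, read at an
# ARBITRARY cumulant letter `c` (N08's `StepAlphaEq324CoreLTAtAC` rows `hG` :300 ∕ `h324` :303 currency), so that the THREE rows {`h324`, `hloc58`, `hlocLow`} stand in
# for the NINE rows {#1–5, #14–17} in everything the lane reads from them (C3 ∕ C4)» (cell `ym3-torus`, RECORD 17cf (R1)∕(R2′); seat `ym-line-cst-p1` g37, free hand;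
# companion of ✓`AlphaInputsT3ACLoc59RowsOfGraphPair` (p775232, (D→)) and ✓`AlphaInputsT3ACCumulantLeavesOfLoc59Rows` (p776073, (D←)); `--supports stmt-QuantumFields-19936 --as helper`;
# CREDITS NOTHING)

THE POINT.  The two landed doors are typed at the DEFINED letter `(𝔖 k).cum` and at today's TILTED (3.24) rows #16∕#17 (+ the five regularity rows #1–5).  RECORD 17cf recommends
two re-cuts after the freeze: (R1) {#1–5, #16, #17} ↦ N08's ONE printed row `h324 : Eq324 (∫_{box h} e^{𝒱 h U} dμ) (c k h U) n̄ (Ca + Cc) (Lᵏg₀²) (3+κ₀) |T₁^{(k)}|` at a cumulant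
LETTER `c` (✓`BalabanUVNodesN08AlphaEq324RowAC.StepAlphaEq324CoreLTAtAC.h324`), and (R2′) {#14, #15} ↦ {`hloc58`, `hlocLow`}.  This file types the door editions that serve BOTH
at once, at the letter:
* §0 `rret_nonneg` ∕ `largeDomain_le_rem` — the two run-slot bookings shared by the (59) rows (`0 ≤ R₁·r(g_k)`; `C25·g_k·K₀·N³·e^{−Rret} ≤ C25·K₀·e^{−R₁}·rem`, p3 `largeLoc_le_normRem`).
* §1 ★★ `hloc58_at_of_hact_hG` ∕ `hlocLow_at_of_hact_hG` — (D→) AT THE LETTER: R-ACT `hact` + G3D-02 `hG` representing `Σ_{n≤n̄} c h U n∕n!` (N08 :300 shape) + (25) ⟹ the re-cut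
  rows for `c` (✓p775232 is the instance `c := (𝔖 k).cum`).
* §2 ★★★ `cumulant58_piecesAC_of_h324_hloc58` ∕ `cumulantLower_piecesAC_of_h324_hlocLow` — (D←) AT THE LETTER: N08's printed row `h324` at `c` (:303 VERBATIM with `c k ↦ c`) + the
  re-cut row at `c` ⟹ C3 `Cumulant58 (piecesAC 𝔠.lane X 𝔖 k) 𝔠.lane.sc.Cz 𝔠.lane.sc.C₁` ∕ C4 `CumulantLower … 𝔠.lane.sc.C₁'` — NO regularity rows, NO `Gt`, NO (25), NO run slot.
* §3 ★★ `cumulant58_piecesAC_of_printedRows` ∕ `cumulantLower_piecesAC_of_printedRows` — the round trip at the letter: N08's rows {`hact`, `hG (c)`, `h324 (c)`} + (25) ⟹ C3 ∕ C4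
  THROUGH the re-cut rows (§2 ∘ §1).  DOORFIT: the direct road with the same inputs is N08's ✓`cumulant58_piecesAC_of_eq324_at` :177 (read at `𝔎 := 𝔠.lane`, its `hCz`∕`hC₁`∕`hC₂`
  equations `rfl`, its constant slots the record's).
* §4 ★ `h324_cum_of_tiltedRows` — the (R1) «7 → 1» row-door as a STANDALONE lemma: today's {#1 `hμ`, #2–3 `hboxm`∕`hbox`, #4–5 `hVm`∕`hVB`, #16 `h324a`, #17 `h324c`} ⟹ N08's
  `h324` AT THE DEFINED LETTER `(𝔖 k).cum` (N08 has the same three lines only inside the structure map ✓`stepCoreLTAtAC_of_stepAlphaAC` :366) — so that ✓p776073's (D←)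
  `cumulant58_piecesAC_of_hloc58` FACTORS as §2 ∘ §4 (same hypotheses, same conclusion; the (R1) and (R2′) door editions commute).
* §5 (appended) ★★ `hloc58_at_of_h2459` ∕ `hlocLow_at_of_h2459` + ★★★ `cumulant58_piecesAC_of_print` ∕ `cumulantLower_piecesAC_of_print` — the (R2) ONE-ROW edition: print's
  (24)∘(58)–(59) IDENTITY `h2459 : Σ_{n≤n̄} c h U n∕n! = Σ_Y (𝔖 k).act h Y U` + (25) ⟹ the re-cut rows at `c` (no `Gt` at all), hence with `h324` ⟹ C3 ∕ C4: THREE PRINTED rows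
  {(24)∘(58)–(59), (25), (3.24)} for the NINE typed rows {#1–5, #14–17} — the (R1)+(R2) terminal door (today's pair {`hact`, `hG`} is the instance by
  ✓`AlphaInputsT3ACGraphPairOfIdentity.sum_cum_eq_sum_act_of_rows`).
HONEST SCOPE: doors over landed carriers; (α) data rows 0∕23 unchanged; no registry∕binder∕`closes` touched; the (59) localisation rows, the printed (3.24) row and (25) are
HYPOTHESES; nothing of (O‴χₛ), `HistoryTailL` (19936), EX, `YM3TorusSU2` (R3 — SU(2) YM₃ on T³, a RECORD rung: NOT d = 4, NOT infinite volume, NOT a mass gap, NOT Clay) is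
proved; the Yang–Mills mass gap is NOT proved.

References: T. Bałaban, Commun. Math. Phys. **102** (1985) 255–275 [Balaban1985UV3] ((23)–(25) p.262, (58)–(59) p.270, (37) p.265, p.272); Commun. Math. Phys. **85** (1982)
603–636 [Balaban1982Higgs1] ((3.24) p.616).
-/

set_option autoImplicit false

noncomputable section

namespace Summit.QuantumFields.YangMills.Theorems.AlphaV3CumulantLeavesAtLetter

open scoped BigOperators Nat
open MeasureTheory Metric
open Literature.MathematicalPhysics.QuantumFieldTheory.Balaban1983to89
open Literature.MathematicalPhysics.QuantumFieldTheory.Balaban1983to89.B10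
open Literature.MathematicalPhysics.QuantumFieldTheory.Balaban1983to89.B10SectAGathering (Cumulant58 CumulantLower)
open Literature.MathematicalPhysics.QuantumFieldTheory.Balaban1983to89.B10Eq24Cumulant (chiMeasure truncExp)
open Literature.MathematicalPhysics.QuantumFieldTheory.Balaban1983to89.B12TreeDecay (K₀ K₀_pos)
open Literature.MathematicalPhysics.QuantumFieldTheory.Balaban1983to89.TreeLengthTorus (tsys tcubeSys tdegreeLE tvolumeLeaf card_tcube)
open Literature.MathematicalPhysics.QuantumFieldTheory.Balaban1983to89.B1Sect3Statements (Eq324)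
open Literature.MathematicalPhysics.QuantumFieldTheory.Balaban1985CMP102
open Literature.MathematicalPhysics.QuantumFieldTheory.Balaban1985CMP102.Setting
open Literature.MathematicalPhysics.QuantumFieldTheory.Balaban1985CMP102.Binders (GraphRep23AsCited)
open Summit.QuantumFields.Balaban3D.Carriers
open Summit.QuantumFields.Balaban3D.Proofs
open Summit.QuantumFields.Balaban3D.Proofs.ScalesArithmetic (gk_pos gk_le_one largeLoc_le_normRem norm_rem_eq)
open Summit.QuantumFields.Balaban3D.Proofs.Primitives
open Summit.QuantumFields.Balaban3D.Proofs.TowerAC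
open Summit.QuantumFields.Balaban3D.Proofs.SeriesAC
open Summit.QuantumFields.Balaban3D.Proofs.StandardAC
open Summit.QuantumFields.Balaban3D.Proofs.InputsAC
open Summit.QuantumFields.Balaban3D.Proofs.Inputs (nblk_cube_le_sites)
open Summit.QuantumFields.Balaban3D.Proofs.GroupModelLieC (lieC)

variable {L : ℕ} {S : Scales L} {G : Type} [GaugeGroup G] [MeasurableSpace G] [HaarData G] (𝔊 : GroupModel G) (𝔠 : AlphaConsts L 𝔊.N)
  (X : ExternalInputsAC S G) (𝔖 : ∀ k, StepSeries S G ↥(lieC 𝔊) (nblkOf S 𝔠.lane.carrier k) k) (k : ℕ)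

/-! ## §0 The two run-slot bookings shared by the (59) rows -/

/-- `0 ≤ Rret_k = R₁·r(g_k)` for `k < K` (`0 ≤ R₁`, p3 `rFun_nonneg` on `0 < g_k ≤ 1`). [cite: Balaban1985UV3, (31) p.264] -/
theorem rret_nonneg (hk : k + 1 ≤ S.K) : 0 ≤ (X.toTowerBase 𝔠.lane.carrier).Rret k := by
  show 0 ≤ 𝔠.R₁ * rFun 𝔠.r₀ (S.gk k)
  exact mul_nonneg 𝔠.R₁_nonneg (VacuumAndBooking.rFun_nonneg 𝔠.r₀ (S.gk k) (gk_pos S k) (gk_le_one S S.gK_le_one k (by omega)))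

/-- **The large-domain booking** `C25·g_k·K₀(32,6)·|cubes|·e^{−Rret_k} ≤ (C25·K₀(32,6)·e^{−R₁})·rem` for `k < K` — `|cubes| = N³ ≤ |T₁^{(k)}|` (`card_tcube`, `nblk_cube_le_sites`),
`rem = (g_k²)^{3+κ₀}|T₁^{(k)}|` (`rfl`), and p3 `largeLoc_le_normRem` (`r₀ ≥ 1`, `R₁ ≥ 2(3+κ₀)`). [cite: Balaban1985UV3, (59) p.270 + (31) p.264] -/
theorem largeDomain_le_rem (hk : k + 1 ≤ S.K) :
    (𝔠.C25 * S.gk k * K₀ (4 * 2 ^ 3) (2 * 3) * (Fintype.card (tcubeSys 3 (nblkOf S 𝔠.lane.carrier k)).Cube : ℝ))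
      * Real.exp (-(X.toTowerBase 𝔠.lane.carrier).Rret k) ≤
        (𝔠.C25 * K₀ (4 * 2 ^ 3) (2 * 3) * Real.exp (-𝔠.R₁)) * (piecesAC 𝔠.lane X 𝔖 k).rem := by
  have hK₀ : 0 ≤ K₀ (4 * 2 ^ 3) (2 * 3) := (K₀_pos _ _).le
  have hcard : (Fintype.card (tcubeSys 3 (nblkOf S 𝔠.lane.carrier k)).Cube : ℝ) = ((nblkOf S 𝔠.lane.carrier k : ℕ) : ℝ) ^ 3 := by
    rw [card_tcube]; push_cast; rfl
  have hblocks : ((nblkOf S 𝔠.lane.carrier k : ℕ) : ℝ) ^ 3 ≤ S.sites k := nblk_cube_le_sites 𝔠.lane k (by omega)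
  have hκ3 : (0 : ℝ) ≤ 3 + 𝔠.lane.carrier.κ₀ := by show (0 : ℝ) ≤ 3 + 𝔠.κ₀; linarith [𝔠.κ₀_pos]
  have hR2 : 2 * (3 + 𝔠.lane.carrier.κ₀) ≤ 𝔠.R₁ := by show 2 * (3 + 𝔠.κ₀) ≤ 𝔠.R₁; linarith [𝔠.R₁_ge]
  have hle := largeLoc_le_normRem S (r₀ := 𝔠.r₀) (R₁ := 𝔠.R₁) (κ₀ := 𝔠.lane.carrier.κ₀) (A := 𝔠.C25 * K₀ (4 * 2 ^ 3) (2 * 3))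
    (vol := ((nblkOf S 𝔠.lane.carrier k : ℕ) : ℝ) ^ 3) k (by omega) 𝔠.one_le_r₀ hκ3 hR2
    (mul_nonneg 𝔠.C25_nonneg hK₀) (by positivity) hblocks
  have hrem : (piecesAC 𝔠.lane X 𝔖 k).rem = (S.gk k ^ 2) ^ (3 + 𝔠.lane.carrier.κ₀) * S.sites k := rfl
  rw [hcard, hrem]
  calc 𝔠.C25 * S.gk k * K₀ (4 * 2 ^ 3) (2 * 3) * ((nblkOf S 𝔠.lane.carrier k : ℕ) : ℝ) ^ 3 * Real.exp (-(X.toTowerBase 𝔠.lane.carrier).Rret k)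
      = 𝔠.C25 * K₀ (4 * 2 ^ 3) (2 * 3) * S.gk k * ((nblkOf S 𝔠.lane.carrier k : ℕ) : ℝ) ^ 3 * Real.exp (-(𝔠.R₁ * rFun 𝔠.r₀ (S.gk k))) := by
        show _ * Real.exp (-(𝔠.R₁ * rFun 𝔠.r₀ (S.gk k))) = _; ring
    _ ≤ 𝔠.C25 * K₀ (4 * 2 ^ 3) (2 * 3) * Real.exp (-𝔠.R₁) * ((S.gk k ^ 2) ^ (3 + 𝔠.lane.carrier.κ₀) * S.sites k) := hle

/-! ## §1 (D→) at the letter: the two (59)-localisation rows for an arbitrary cumulant letter `c` -/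

open Classical in
/-- ★★ **ROW `hloc58` AT THE CUMULANT LETTER `c` FROM R-ACT `hact` + G3D-02 `hG` (representing `Σ_{n≤n̄} c h U n∕n!`, N08's field shape) + (25)**: at every history `h` and coarse
field `U`, `Σ_{n ≤ n̄} c h U n∕n! ≤ PprU + (C25·K₀(32,6))·g_k·|Z_k(h)| + (C25·K₀(32,6)·e^{−R₁})·rem` — ✓`Cumulant59.loc59_upper_of_bound25` with `cum := c`, `hrep := (hG h).cum_eq_sum_activities ∘ hact`,
the (59) sum by `rfl`, `hZ` = p1's block count, §0.  ✓`AlphaV3Loc59RowsOfGraphPair.hloc58_of_hact_hG` is the instance `c := (𝔖 k).cum`. [cite: Balaban1985UV3, (59) p.270 + (23)–(25) p.262] -/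
theorem hloc58_at_of_hact_hG (c : Hist S.P (k + 1) → GaugeField S.P (k + 1) G → ℕ → ℝ) (hk : k + 1 ≤ S.K) {C₂₃ c₂₃ M₂₃ δ₀ : ℝ}
    (hact : ∀ h Y U, ((𝔖 k).Gt h).activities.act Y U = (𝔖 k).act h Y U)
    (hG : ∀ h, GraphRep23AsCited ((𝔖 k).Gt h) (fun U => ∑ n ∈ Finset.Icc 1 𝔠.nbar, c h U n / (n.factorial : ℝ)) C₂₃ c₂₃ M₂₃ δ₀)
    (h25 : ∀ h, Bound25Printed ⟨(tsys 3 (nblkOf S 𝔠.lane.carrier k)).Dom, GaugeField S.P (k + 1) G, (tsys 3 (nblkOf S 𝔠.lane.carrier k)).dj,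
      (𝔖 k).act h⟩ (S.gk k) 𝔠.κ 𝔠.C25) :
    ∀ (h : Hist S.P (k + 1)) (U : GaugeField S.P (k + 1) G),
      ∑ n ∈ Finset.Icc 1 𝔠.nbar, c h U n / (n ! : ℝ)
        ≤ (piecesAC 𝔠.lane X 𝔖 k).PprU h U + (𝔠.C25 * K₀ (4 * 2 ^ 3) (2 * 3)) * S.gk k * (piecesAC 𝔠.lane X 𝔖 k).Zvol h
          + (𝔠.C25 * K₀ (4 * 2 ^ 3) (2 * 3) * Real.exp (-𝔠.R₁)) * (piecesAC 𝔠.lane X 𝔖 k).rem := by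
  classical
  intro h U
  exact loc59_upper_of_bound25 (tcubeSys 3 (nblkOf S 𝔠.lane.carrier k)) (piecesAC 𝔠.lane X 𝔖 k)
    (tdegreeLE 3 _) (tvolumeLeaf 3 _) 𝔠.kappa_ge c (𝔖 k).act
    (fun h' => ΩblkOf (P := S.P) 𝔠.lane.carrier.M₁ (rcolOf S 𝔠.lane.carrier) (nblkOf S 𝔠.lane.carrier k) h')
    (rret_nonneg 𝔊 𝔠 X k hk) (mul_nonneg 𝔠.C25_nonneg (gk_pos S k).le) h25
    (fun h' U' => by rw [(hG h').cum_eq_sum_activities U']; exact Finset.sum_congr rfl fun Y _ => hact h' Y U')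
    (fun h' U' => by rw [← sum_filter_and_eq]; rfl)
    (fun h' => (X.toTowerBase 𝔠.lane.carrier).seriesPiecesAC_hZ 𝔖 (piecesParamsOf S 𝔠.lane.carrier) k h')
    (largeDomain_le_rem 𝔊 𝔠 X 𝔖 k hk) h U

open Classical in
/-- ★★ **ROW `hlocLow` AT THE CUMULANT LETTER `c` FROM `hact` + `hG` + (25)**: at the trivial history (`|Z_k| = 0`, p.272),
`PprU − (C25·K₀(32,6)·e^{−R₁})·rem ≤ Σ_{n ≤ n̄} c (triv) U n∕n!` — ✓`Cumulant59.loc59_lower_of_bound25`, same feeds.  ✓`hlocLow_of_hact_hG` is the instance `c := (𝔖 k).cum`.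
[cite: Balaban1985UV3, p.272 + (59) p.270] -/
theorem hlocLow_at_of_hact_hG (c : Hist S.P (k + 1) → GaugeField S.P (k + 1) G → ℕ → ℝ) (hk : k + 1 ≤ S.K) {C₂₃ c₂₃ M₂₃ δ₀ : ℝ}
    (hact : ∀ h Y U, ((𝔖 k).Gt h).activities.act Y U = (𝔖 k).act h Y U)
    (hG : ∀ h, GraphRep23AsCited ((𝔖 k).Gt h) (fun U => ∑ n ∈ Finset.Icc 1 𝔠.nbar, c h U n / (n.factorial : ℝ)) C₂₃ c₂₃ M₂₃ δ₀)
    (h25 : ∀ h, Bound25Printed ⟨(tsys 3 (nblkOf S 𝔠.lane.carrier k)).Dom, GaugeField S.P (k + 1) G, (tsys 3 (nblkOf S 𝔠.lane.carrier k)).dj,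
      (𝔖 k).act h⟩ (S.gk k) 𝔠.κ 𝔠.C25) :
    ∀ U : GaugeField S.P (k + 1) G,
      (piecesAC 𝔠.lane X 𝔖 k).PprU (Hist.triv S.P (k + 1)) U - (𝔠.C25 * K₀ (4 * 2 ^ 3) (2 * 3) * Real.exp (-𝔠.R₁)) * (piecesAC 𝔠.lane X 𝔖 k).rem
        ≤ ∑ n ∈ Finset.Icc 1 𝔠.nbar, c (Hist.triv S.P (k + 1)) U n / (n ! : ℝ) := by
  classical
  intro U
  exact loc59_lower_of_bound25 (tcubeSys 3 (nblkOf S 𝔠.lane.carrier k)) (piecesAC 𝔠.lane X 𝔖 k)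
    (tdegreeLE 3 _) (tvolumeLeaf 3 _) 𝔠.kappa_ge c (𝔖 k).act
    (fun h' => ΩblkOf (P := S.P) 𝔠.lane.carrier.M₁ (rcolOf S 𝔠.lane.carrier) (nblkOf S 𝔠.lane.carrier k) h')
    (rret_nonneg 𝔊 𝔠 X k hk) (mul_nonneg 𝔠.C25_nonneg (gk_pos S k).le) h25
    (fun h' U' => by rw [(hG h').cum_eq_sum_activities U']; exact Finset.sum_congr rfl fun Y _ => hact h' Y U')
    (fun h' U' => by rw [← sum_filter_and_eq]; rfl)
    (fun h' => (X.toTowerBase 𝔠.lane.carrier).seriesPiecesAC_hZ 𝔖 (piecesParamsOf S 𝔠.lane.carrier) k h')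
    (largeDomain_le_rem 𝔊 𝔠 X 𝔖 k hk) U

/-! ## §2 (D←) at the letter: C3 ∕ C4 from N08's printed row `h324` + the re-cut row, both at `c` -/

/-- ★★★ **C3 `Cumulant58` AT THE RECORD CONSTANTS FROM THE PRINTED (3.24) ROW AND THE RE-CUT ROW `hloc58`, BOTH AT THE LETTER `c`** ((24) p.262 ∕ (58)–(59) p.270 ∕ [B1] (3.24)):
`h324` is N08's field `StepAlphaEq324CoreLTAtAC.h324` :303 VERBATIM (with `c k ↦ c`), `hloc58` the UPPER (59)-localisation row at `c`; conclusion = ✓`AlphaAdaptersAC.cumulant58_piecesAC`'s at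
`𝔎 := 𝔠.lane` — NO regularity rows #1–5, NO tilted rows #16–17, NO `Gt`∕`hact`∕`hG`, NO (25), NO run slot.  Proof: `logFl = log ∫_{box} e^{𝒱} dμ` (`rfl`), ✓`B1Eq324CumulantTaylor.abs_log_sub_le_of_eq324`,
`rem` by ✓`norm_rem_eq`, `ring`. [cite: Balaban1985UV3, (24) p.262 + (58)–(59) p.270; Balaban1982Higgs1, (3.24) p.616] -/
theorem cumulant58_piecesAC_of_h324_hloc58 (c : Hist S.P (k + 1) → GaugeField S.P (k + 1) G → ℕ → ℝ)
    (h324 : ∀ h (U : GaugeField S.P (k + 1) G),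
      Eq324 (∫ ω in (𝔖 k).box h, Real.exp ((𝔖 k).𝒱 h U ω) ∂(𝔖 k).μ) (c h U) 𝔠.nbar (𝔠.Ca + 𝔠.Cc)
        ((L : ℝ) ^ k * S.g0sq) (3 + 𝔠.κ₀) (S.sites k))
    (hloc58 : ∀ (h : Hist S.P (k + 1)) (U : GaugeField S.P (k + 1) G),
      ∑ n ∈ Finset.Icc 1 𝔠.nbar, c h U n / (n ! : ℝ)
        ≤ (piecesAC 𝔠.lane X 𝔖 k).PprU h U + (𝔠.C25 * K₀ (4 * 2 ^ 3) (2 * 3)) * S.gk k * (piecesAC 𝔠.lane X 𝔖 k).Zvol h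
          + (𝔠.C25 * K₀ (4 * 2 ^ 3) (2 * 3) * Real.exp (-𝔠.R₁)) * (piecesAC 𝔠.lane X 𝔖 k).rem) :
    Cumulant58 (piecesAC 𝔠.lane X 𝔖 k) 𝔠.lane.sc.Cz 𝔠.lane.sc.C₁ := by
  have hrem : ((L : ℝ) ^ k * S.g0sq) ^ (3 + 𝔠.κ₀) * S.sites k ≤ (piecesAC 𝔠.lane X 𝔖 k).rem := by
    rw [norm_rem_eq S 𝔠.κ₀ k]
    exact le_of_eq rfl
  intro (h : Hist S.P (k + 1)) (U : GaugeField S.P (k + 1) G)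
  show (piecesAC 𝔠.lane X 𝔖 k).logFl h U ≤ (piecesAC 𝔠.lane X 𝔖 k).PprU h U
      + 𝔠.C25 * K₀ (4 * 2 ^ 3) (2 * 3) * S.gk k * (piecesAC 𝔠.lane X 𝔖 k).Zvol h
      + (0 + 𝔠.C25 * K₀ (4 * 2 ^ 3) (2 * 3) * Real.exp (-𝔠.R₁) + (𝔠.Ca + 0 + 𝔠.Cc)) * (piecesAC 𝔠.lane X 𝔖 k).rem
  have h1 : (piecesAC 𝔠.lane X 𝔖 k).logFl h U = Real.log (∫ ω in (𝔖 k).box h, Real.exp ((𝔖 k).𝒱 h U ω) ∂(𝔖 k).μ) := rfl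
  have h2 := (abs_le.1 (B1Eq324CumulantTaylor.abs_log_sub_le_of_eq324 (h324 h U))).2
  have h3 := hloc58 h U
  have hC : 0 ≤ 𝔠.Ca + 𝔠.Cc := 𝔠.Cac_nonneg
  have h4 : (𝔠.Ca + 𝔠.Cc) * ((L : ℝ) ^ k * S.g0sq) ^ (3 + 𝔠.κ₀) * S.sites k ≤ (𝔠.Ca + 𝔠.Cc) * (piecesAC 𝔠.lane X 𝔖 k).rem := by
    rw [mul_assoc]; exact mul_le_mul_of_nonneg_left hrem hC
  rw [h1]
  refine (sub_le_iff_le_add'.mp h2).trans ((add_le_add h3 h4).trans_eq ?_)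
  ring

/-- ★★★ **C4 `CumulantLower` AT THE RECORD CONSTANT FROM THE PRINTED (3.24) ROW AND THE RE-CUT ROW `hlocLow`, BOTH AT THE LETTER `c`** ((37) p.265 ∕ p.272): same data at the
trivial history; conclusion = ✓`AlphaAdaptersAC.cumulantLower_piecesAC`'s at `𝔎 := 𝔠.lane` (`C₁' = C₁`). [cite: Balaban1985UV3, (37) p.265 + p.272 + (59) p.270; Balaban1982Higgs1, (3.24) p.616] -/
theorem cumulantLower_piecesAC_of_h324_hlocLow (c : Hist S.P (k + 1) → GaugeField S.P (k + 1) G → ℕ → ℝ)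
    (h324 : ∀ h (U : GaugeField S.P (k + 1) G),
      Eq324 (∫ ω in (𝔖 k).box h, Real.exp ((𝔖 k).𝒱 h U ω) ∂(𝔖 k).μ) (c h U) 𝔠.nbar (𝔠.Ca + 𝔠.Cc)
        ((L : ℝ) ^ k * S.g0sq) (3 + 𝔠.κ₀) (S.sites k))
    (hlocLow : ∀ U : GaugeField S.P (k + 1) G,
      (piecesAC 𝔠.lane X 𝔖 k).PprU (Hist.triv S.P (k + 1)) U - (𝔠.C25 * K₀ (4 * 2 ^ 3) (2 * 3) * Real.exp (-𝔠.R₁)) * (piecesAC 𝔠.lane X 𝔖 k).rem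
        ≤ ∑ n ∈ Finset.Icc 1 𝔠.nbar, c (Hist.triv S.P (k + 1)) U n / (n ! : ℝ)) :
    CumulantLower (piecesAC 𝔠.lane X 𝔖 k) 𝔠.lane.sc.C₁' := by
  have hrem : ((L : ℝ) ^ k * S.g0sq) ^ (3 + 𝔠.κ₀) * S.sites k ≤ (piecesAC 𝔠.lane X 𝔖 k).rem := by
    rw [norm_rem_eq S 𝔠.κ₀ k]
    exact le_of_eq rfl
  intro (U : GaugeField S.P (k + 1) G)
  show (piecesAC 𝔠.lane X 𝔖 k).PprU (Hist.triv S.P (k + 1)) U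
      - (0 + 𝔠.C25 * K₀ (4 * 2 ^ 3) (2 * 3) * Real.exp (-𝔠.R₁) + (𝔠.Ca + 0 + 𝔠.Cc)) * (piecesAC 𝔠.lane X 𝔖 k).rem
        ≤ (piecesAC 𝔠.lane X 𝔖 k).logFl (Hist.triv S.P (k + 1)) U
  have h1 : (piecesAC 𝔠.lane X 𝔖 k).logFl (Hist.triv S.P (k + 1)) U =
      Real.log (∫ ω in (𝔖 k).box (Hist.triv S.P (k + 1)), Real.exp ((𝔖 k).𝒱 (Hist.triv S.P (k + 1)) U ω) ∂(𝔖 k).μ) := rfl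
  have h2 := (abs_le.1 (B1Eq324CumulantTaylor.abs_log_sub_le_of_eq324 (h324 (Hist.triv S.P (k + 1)) U))).1
  have h3 := hlocLow U
  have hC : 0 ≤ 𝔠.Ca + 𝔠.Cc := 𝔠.Cac_nonneg
  have h4 : (𝔠.Ca + 𝔠.Cc) * ((L : ℝ) ^ k * S.g0sq) ^ (3 + 𝔠.κ₀) * S.sites k ≤ (𝔠.Ca + 𝔠.Cc) * (piecesAC 𝔠.lane X 𝔖 k).rem := by
    rw [mul_assoc]; exact mul_le_mul_of_nonneg_left hrem hC
  rw [h1]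
  have e1 := (sub_le_sub h3 h4).trans (sub_le_iff_le_add.mpr (neg_le_sub_iff_le_add.mp h2))
  refine (le_of_eq ?_).trans e1
  ring

/-! ## §3 The round trip at the letter: N08's rows {`hact`, `hG (c)`, `h324 (c)`} + (25) ⟹ C3 ∕ C4 through the re-cut rows -/

open Classical in
/-- ★★ **C3 FROM N08's PRINTED ROWS THROUGH THE RE-CUT ROW** — `hact` + `hG` (letter `c`) + (25) + `h324` (letter `c`) ⟹ `Cumulant58 (piecesAC 𝔠.lane X 𝔖 k) 𝔠.lane.sc.Cz 𝔠.lane.sc.C₁`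
:= §2 ∘ §1.  DOORFIT: the direct road on the same inputs is N08's ✓`BalabanUVNodesN08AlphaEq324RowAC.cumulant58_piecesAC_of_eq324_at` (at `𝔎 := 𝔠.lane`).
[cite: Balaban1985UV3, (24) p.262 + (58)–(59) p.270; Balaban1982Higgs1, (3.24) p.616] -/
theorem cumulant58_piecesAC_of_printedRows (c : Hist S.P (k + 1) → GaugeField S.P (k + 1) G → ℕ → ℝ) (hk : k + 1 ≤ S.K) {C₂₃ c₂₃ M₂₃ δ₀ : ℝ}
    (hact : ∀ h Y U, ((𝔖 k).Gt h).activities.act Y U = (𝔖 k).act h Y U)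
    (hG : ∀ h, GraphRep23AsCited ((𝔖 k).Gt h) (fun U => ∑ n ∈ Finset.Icc 1 𝔠.nbar, c h U n / (n.factorial : ℝ)) C₂₃ c₂₃ M₂₃ δ₀)
    (h25 : ∀ h, Bound25Printed ⟨(tsys 3 (nblkOf S 𝔠.lane.carrier k)).Dom, GaugeField S.P (k + 1) G, (tsys 3 (nblkOf S 𝔠.lane.carrier k)).dj,
      (𝔖 k).act h⟩ (S.gk k) 𝔠.κ 𝔠.C25)
    (h324 : ∀ h (U : GaugeField S.P (k + 1) G),
      Eq324 (∫ ω in (𝔖 k).box h, Real.exp ((𝔖 k).𝒱 h U ω) ∂(𝔖 k).μ) (c h U) 𝔠.nbar (𝔠.Ca + 𝔠.Cc)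
        ((L : ℝ) ^ k * S.g0sq) (3 + 𝔠.κ₀) (S.sites k)) :
    Cumulant58 (piecesAC 𝔠.lane X 𝔖 k) 𝔠.lane.sc.Cz 𝔠.lane.sc.C₁ :=
  cumulant58_piecesAC_of_h324_hloc58 𝔊 𝔠 X 𝔖 k c h324 (hloc58_at_of_hact_hG 𝔊 𝔠 X 𝔖 k c hk hact hG h25)

open Classical in
/-- ★★ **C4 FROM N08's PRINTED ROWS THROUGH THE RE-CUT ROW** — the lower twin at the trivial history := §2 ∘ §1.  DOORFIT: N08's ✓`cumulantLower_piecesAC_of_eq324_at`.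
[cite: Balaban1985UV3, (37) p.265 + p.272 + (59) p.270; Balaban1982Higgs1, (3.24) p.616] -/
theorem cumulantLower_piecesAC_of_printedRows (c : Hist S.P (k + 1) → GaugeField S.P (k + 1) G → ℕ → ℝ) (hk : k + 1 ≤ S.K) {C₂₃ c₂₃ M₂₃ δ₀ : ℝ}
    (hact : ∀ h Y U, ((𝔖 k).Gt h).activities.act Y U = (𝔖 k).act h Y U)
    (hG : ∀ h, GraphRep23AsCited ((𝔖 k).Gt h) (fun U => ∑ n ∈ Finset.Icc 1 𝔠.nbar, c h U n / (n.factorial : ℝ)) C₂₃ c₂₃ M₂₃ δ₀)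
    (h25 : ∀ h, Bound25Printed ⟨(tsys 3 (nblkOf S 𝔠.lane.carrier k)).Dom, GaugeField S.P (k + 1) G, (tsys 3 (nblkOf S 𝔠.lane.carrier k)).dj,
      (𝔖 k).act h⟩ (S.gk k) 𝔠.κ 𝔠.C25)
    (h324 : ∀ h (U : GaugeField S.P (k + 1) G),
      Eq324 (∫ ω in (𝔖 k).box h, Real.exp ((𝔖 k).𝒱 h U ω) ∂(𝔖 k).μ) (c h U) 𝔠.nbar (𝔠.Ca + 𝔠.Cc)
        ((L : ℝ) ^ k * S.g0sq) (3 + 𝔠.κ₀) (S.sites k)) :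
    CumulantLower (piecesAC 𝔠.lane X 𝔖 k) 𝔠.lane.sc.C₁' :=
  cumulantLower_piecesAC_of_h324_hlocLow 𝔊 𝔠 X 𝔖 k c h324 (hlocLow_at_of_hact_hG 𝔊 𝔠 X 𝔖 k c hk hact hG h25)

/-! ## §4 The (R1) «7 → 1» row-door at the defined letter `(𝔖 k).cum`, and the factorisation of ✓p776073's (D←) through the printed row -/

/-- ★ **N08's PRINTED ROW `h324` AT THE DEFINED LETTER `(𝔖 k).cum` FROM TODAY's SEVEN ROWS** {#1 `hμ`, #2 `hboxm`, #3 `hbox`, #4 `hVm`, #5 `hVB`, #16 `h324a`, #17 `h324c`} — the lane's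
Taylor–Lagrange theorem ✓`Eq324Chi.eq324_indicator_of_measurableSet` with the re-expansion input (b) vanishing (`(𝔖 k).cum := truncExp …`, R-324) and `Ca + 0 + Cc = Ca + Cc`; the same three
lines sit inside N08's structure map ✓`stepCoreLTAtAC_of_stepAlphaAC` :366, here as a standalone row lemma — with it ✓p776073's `cumulant58_piecesAC_of_hloc58 hμ … h324c hloc58` is
`cumulant58_piecesAC_of_h324_hloc58 𝔊 𝔠 X 𝔖 k (𝔖 k).cum (h324_cum_of_tiltedRows 𝔊 𝔠 𝔖 k hμ … h324c) hloc58` (the (R1) and (R2′) door editions commute; kernel-checked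
in the seat's DOORFIT cert, not restated here). [cite: Balaban1982Higgs1, (3.24) p.616; Balaban1985UV3, (58) p.270] -/
theorem h324_cum_of_tiltedRows (hμ : IsProbabilityMeasure (𝔖 k).μ) {Bv : ℝ}
    (hboxm : ∀ h, MeasurableSet ((𝔖 k).box h)) (hbox : ∀ h, (𝔖 k).μ ((𝔖 k).box h) ≠ 0)
    (hVm : ∀ h U, AEMeasurable ((𝔖 k).𝒱 h U) (𝔖 k).μ)
    (hVB : ∀ h U, ∀ ω ∈ (𝔖 k).box h, |(𝔖 k).𝒱 h U ω| ≤ Bv)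
    (h324a : ∀ h (U : GaugeField S.P (k + 1) G), |Real.log ((𝔖 k).μ.real ((𝔖 k).box h))| ≤
      𝔠.Ca * ((L : ℝ) ^ k * S.g0sq) ^ (3 + 𝔠.κ₀) * S.sites k)
    (h324c : ∀ h U, ∀ t ∈ Set.Icc (0 : ℝ) 1, |iteratedDeriv (𝔠.nbar + 1) (ProbabilityTheory.cgf ((𝔖 k).𝒱 h U)
      (chiMeasure (𝔖 k).μ (((𝔖 k).box h).indicator fun _ => (1 : ℝ)))) t| ≤
        𝔠.Cc * ((𝔠.nbar + 1).factorial : ℝ) * ((L : ℝ) ^ k * S.g0sq) ^ (3 + 𝔠.κ₀) * S.sites k) :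
    ∀ h (U : GaugeField S.P (k + 1) G),
      Eq324 (∫ ω in (𝔖 k).box h, Real.exp ((𝔖 k).𝒱 h U ω) ∂(𝔖 k).μ) ((𝔖 k).cum h U) 𝔠.nbar (𝔠.Ca + 𝔠.Cc)
        ((L : ℝ) ^ k * S.g0sq) (3 + 𝔠.κ₀) (S.sites k) := by
  haveI := hμ
  intro h U
  have h0 := eq324_indicator_of_measurableSet (C₂ := 0) (𝔖 k).μ (hboxm h) (hbox h) (hVm h U) (hVB h U)
    𝔠.nbar ((𝔖 k).cum h U) (h324a h U) (by simp [StepSeries.cum]) (h324c h U)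
  simpa only [add_zero] using h0

/-! ## §5 (appended) The (R2) ONE-ROW edition closed against C3 ∕ C4: print's (24)∘(58)–(59) IDENTITY `h2459` + (25) + [B1] (3.24) — three PRINTED rows
for the nine typed ones {#1–5, #14–17}; no graph carrier `Gt`, no R-ACT, no G3D-02 walk clauses (RECORD 17cf (R2)∕(R5); ✓`AlphaInputsT3ACGraphPairOfIdentity`
`sum_cum_eq_sum_act_of_rows` makes today's pair {`hact`, `hG`} the instance of `h2459`) -/

open Classical in
/-- ★★ **ROW `hloc58` AT THE LETTER `c` FROM THE PRINTED IDENTITY `h2459` + (25)** — `Σ_{n≤n̄} c h U n∕n! = Σ_Y Re Ψ_Y(B_Y(h,U))` ((24) p.262 ∘ (58)–(59) p.270, the hypothesis of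
✓`Cumulant59.cumulant58_torus` verbatim) and (25) for the chart activities give the upper (59)-localisation row — ✓`Cumulant59.loc59_upper_of_bound25` with `hrep := h2459`; NO `Gt`.
[cite: Balaban1985UV3, (24)–(25) p.262 + (59) p.270] -/
theorem hloc58_at_of_h2459 (c : Hist S.P (k + 1) → GaugeField S.P (k + 1) G → ℕ → ℝ) (hk : k + 1 ≤ S.K)
    (h2459 : ∀ (h : Hist S.P (k + 1)) (U : GaugeField S.P (k + 1) G),
      ∑ n ∈ Finset.Icc 1 𝔠.nbar, c h U n / (n ! : ℝ) = ∑ Y : (tsys 3 (nblkOf S 𝔠.lane.carrier k)).Dom, (𝔖 k).act h Y U)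
    (h25 : ∀ h, Bound25Printed ⟨(tsys 3 (nblkOf S 𝔠.lane.carrier k)).Dom, GaugeField S.P (k + 1) G, (tsys 3 (nblkOf S 𝔠.lane.carrier k)).dj,
      (𝔖 k).act h⟩ (S.gk k) 𝔠.κ 𝔠.C25) :
    ∀ (h : Hist S.P (k + 1)) (U : GaugeField S.P (k + 1) G),
      ∑ n ∈ Finset.Icc 1 𝔠.nbar, c h U n / (n ! : ℝ)
        ≤ (piecesAC 𝔠.lane X 𝔖 k).PprU h U + (𝔠.C25 * K₀ (4 * 2 ^ 3) (2 * 3)) * S.gk k * (piecesAC 𝔠.lane X 𝔖 k).Zvol h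
          + (𝔠.C25 * K₀ (4 * 2 ^ 3) (2 * 3) * Real.exp (-𝔠.R₁)) * (piecesAC 𝔠.lane X 𝔖 k).rem := by
  classical
  intro h U
  exact loc59_upper_of_bound25 (tcubeSys 3 (nblkOf S 𝔠.lane.carrier k)) (piecesAC 𝔠.lane X 𝔖 k)
    (tdegreeLE 3 _) (tvolumeLeaf 3 _) 𝔠.kappa_ge c (𝔖 k).act
    (fun h' => ΩblkOf (P := S.P) 𝔠.lane.carrier.M₁ (rcolOf S 𝔠.lane.carrier) (nblkOf S 𝔠.lane.carrier k) h')
    (rret_nonneg 𝔊 𝔠 X k hk) (mul_nonneg 𝔠.C25_nonneg (gk_pos S k).le) h25 h2459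
    (fun h' U' => by rw [← sum_filter_and_eq]; rfl)
    (fun h' => (X.toTowerBase 𝔠.lane.carrier).seriesPiecesAC_hZ 𝔖 (piecesParamsOf S 𝔠.lane.carrier) k h')
    (largeDomain_le_rem 𝔊 𝔠 X 𝔖 k hk) h U

open Classical in
/-- ★★ **ROW `hlocLow` AT THE LETTER `c` FROM THE PRINTED IDENTITY `h2459` + (25)** (trivial history, `|Z_k| = 0`, p.272) — ✓`Cumulant59.loc59_lower_of_bound25` with `hrep := h2459`.
[cite: Balaban1985UV3, p.272 + (59) p.270 + (24)–(25) p.262] -/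
theorem hlocLow_at_of_h2459 (c : Hist S.P (k + 1) → GaugeField S.P (k + 1) G → ℕ → ℝ) (hk : k + 1 ≤ S.K)
    (h2459 : ∀ (h : Hist S.P (k + 1)) (U : GaugeField S.P (k + 1) G),
      ∑ n ∈ Finset.Icc 1 𝔠.nbar, c h U n / (n ! : ℝ) = ∑ Y : (tsys 3 (nblkOf S 𝔠.lane.carrier k)).Dom, (𝔖 k).act h Y U)
    (h25 : ∀ h, Bound25Printed ⟨(tsys 3 (nblkOf S 𝔠.lane.carrier k)).Dom, GaugeField S.P (k + 1) G, (tsys 3 (nblkOf S 𝔠.lane.carrier k)).dj,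
      (𝔖 k).act h⟩ (S.gk k) 𝔠.κ 𝔠.C25) :
    ∀ U : GaugeField S.P (k + 1) G,
      (piecesAC 𝔠.lane X 𝔖 k).PprU (Hist.triv S.P (k + 1)) U - (𝔠.C25 * K₀ (4 * 2 ^ 3) (2 * 3) * Real.exp (-𝔠.R₁)) * (piecesAC 𝔠.lane X 𝔖 k).rem
        ≤ ∑ n ∈ Finset.Icc 1 𝔠.nbar, c (Hist.triv S.P (k + 1)) U n / (n ! : ℝ) := by
  classical
  intro U
  exact loc59_lower_of_bound25 (tcubeSys 3 (nblkOf S 𝔠.lane.carrier k)) (piecesAC 𝔠.lane X 𝔖 k)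
    (tdegreeLE 3 _) (tvolumeLeaf 3 _) 𝔠.kappa_ge c (𝔖 k).act
    (fun h' => ΩblkOf (P := S.P) 𝔠.lane.carrier.M₁ (rcolOf S 𝔠.lane.carrier) (nblkOf S 𝔠.lane.carrier k) h')
    (rret_nonneg 𝔊 𝔠 X k hk) (mul_nonneg 𝔠.C25_nonneg (gk_pos S k).le) h25 h2459
    (fun h' U' => by rw [← sum_filter_and_eq]; rfl)
    (fun h' => (X.toTowerBase 𝔠.lane.carrier).seriesPiecesAC_hZ 𝔖 (piecesParamsOf S 𝔠.lane.carrier) k h')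
    (largeDomain_le_rem 𝔊 𝔠 X 𝔖 k hk) U

/-- ★★★ **C3 FROM PRINT's THREE DISPLAYED INPUTS AT THE PIECES** — the (24)∘(58)–(59) identity `h2459`, (25) `h25`, [B1] (3.24) `h324`, all at the cumulant letter `c`:
`Cumulant58 (piecesAC 𝔠.lane X 𝔖 k) 𝔠.lane.sc.Cz 𝔠.lane.sc.C₁` := §2 ∘ §5 — the (R1)+(R2) TERMINAL door (three printed rows for the nine typed rows {#1–5, #14–17}; no `Gt`,
no regularity rows, run slot `k + 1 ≤ K` only). [cite: Balaban1985UV3, (24)–(25) p.262 + (58)–(59) p.270; Balaban1982Higgs1, (3.24) p.616] -/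
theorem cumulant58_piecesAC_of_print (c : Hist S.P (k + 1) → GaugeField S.P (k + 1) G → ℕ → ℝ) (hk : k + 1 ≤ S.K)
    (h2459 : ∀ (h : Hist S.P (k + 1)) (U : GaugeField S.P (k + 1) G),
      ∑ n ∈ Finset.Icc 1 𝔠.nbar, c h U n / (n ! : ℝ) = ∑ Y : (tsys 3 (nblkOf S 𝔠.lane.carrier k)).Dom, (𝔖 k).act h Y U)
    (h25 : ∀ h, Bound25Printed ⟨(tsys 3 (nblkOf S 𝔠.lane.carrier k)).Dom, GaugeField S.P (k + 1) G, (tsys 3 (nblkOf S 𝔠.lane.carrier k)).dj,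
      (𝔖 k).act h⟩ (S.gk k) 𝔠.κ 𝔠.C25)
    (h324 : ∀ h (U : GaugeField S.P (k + 1) G),
      Eq324 (∫ ω in (𝔖 k).box h, Real.exp ((𝔖 k).𝒱 h U ω) ∂(𝔖 k).μ) (c h U) 𝔠.nbar (𝔠.Ca + 𝔠.Cc)
        ((L : ℝ) ^ k * S.g0sq) (3 + 𝔠.κ₀) (S.sites k)) :
    Cumulant58 (piecesAC 𝔠.lane X 𝔖 k) 𝔠.lane.sc.Cz 𝔠.lane.sc.C₁ :=
  cumulant58_piecesAC_of_h324_hloc58 𝔊 𝔠 X 𝔖 k c h324 (hloc58_at_of_h2459 𝔊 𝔠 X 𝔖 k c hk h2459 h25)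

/-- ★★★ **C4 FROM PRINT's THREE DISPLAYED INPUTS AT THE PIECES** — the lower twin at the trivial history := §2 ∘ §5.
[cite: Balaban1985UV3, (37) p.265 + p.272 + (59) p.270 + (24)–(25) p.262; Balaban1982Higgs1, (3.24) p.616] -/
theorem cumulantLower_piecesAC_of_print (c : Hist S.P (k + 1) → GaugeField S.P (k + 1) G → ℕ → ℝ) (hk : k + 1 ≤ S.K)
    (h2459 : ∀ (h : Hist S.P (k + 1)) (U : GaugeField S.P (k + 1) G),
      ∑ n ∈ Finset.Icc 1 𝔠.nbar, c h U n / (n ! : ℝ) = ∑ Y : (tsys 3 (nblkOf S 𝔠.lane.carrier k)).Dom, (𝔖 k).act h Y U)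
    (h25 : ∀ h, Bound25Printed ⟨(tsys 3 (nblkOf S 𝔠.lane.carrier k)).Dom, GaugeField S.P (k + 1) G, (tsys 3 (nblkOf S 𝔠.lane.carrier k)).dj,
      (𝔖 k).act h⟩ (S.gk k) 𝔠.κ 𝔠.C25)
    (h324 : ∀ h (U : GaugeField S.P (k + 1) G),
      Eq324 (∫ ω in (𝔖 k).box h, Real.exp ((𝔖 k).𝒱 h U ω) ∂(𝔖 k).μ) (c h U) 𝔠.nbar (𝔠.Ca + 𝔠.Cc)
        ((L : ℝ) ^ k * S.g0sq) (3 + 𝔠.κ₀) (S.sites k)) :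
    CumulantLower (piecesAC 𝔠.lane X 𝔖 k) 𝔠.lane.sc.C₁' :=
  cumulantLower_piecesAC_of_h324_hlocLow 𝔊 𝔠 X 𝔖 k c h324 (hlocLow_at_of_h2459 𝔊 𝔠 X 𝔖 k c hk h2459 h25)

end Summit.QuantumFields.YangMills.Theorems.AlphaV3CumulantLeavesAtLetter

end
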